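import Summits.QuantumAdvantage.QuantumAdvantage.Theorems.CertDialC
import HarnessLib

/-!
# CertDial (D) — decomp-qadv lens-2 (structural dichotomy: special vs generic), generation 28, part 4/4

Part 4 of NODE «CertDial» (memo in part A's header and `NODE-g28.md`): §6 THEOREM C — LEVEL 0 IS COMPLETE FOR THE SPECIAL CLASSES.  Both special
classes of g27 (`IsParityLocal r`, `IsOffsetCombLocal r`) are INPUT-WISE (`InputWise C P := ∀ x, C x (column of P at x)`: the class never couples two
inputs), and for every input-wise class with satisfiable column conditions the quantifiers SWAP:
`(∀ P ∈ 𝒞, ∃ x ∈ 𝒳, P loses on x) ⟺ (∃ x ∈ 𝒳, ∀ P ∈ 𝒞, P loses on x)` (`inputWise_fails_iff_universal`, pure choice; instances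
`parityLocal_fails_iff_universal`, `offsetCombLocal_fails_iff_universal`; hence `pLocalFail_iff_universal`, `offsetCombFail_iff_universal`: the special
pieces ARE «eventually a light universal input exists» — the way g26–g27 proved them is the only way they can hold).  THE DICHOTOMY's other side in the
same language: `generic_no_bounded_witness` (= part C's `no_bounded_universal_family`): for the degree-`≤ D` classes, `D ≥ 1`, not even `M` inputs (any
fixed `M`, `n ≥ (M·w+1)(2M+1)`) defeat every strategy.  Nothing here proves or refutes the generic leaves or 27432.  `lean check` (own closure) rc 0 · 0 sorry ·
0 warning; axioms standard.
-/

set_option linter.dupNamespace false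
set_option linter.style.longLine false

noncomputable section
open scoped Classical

namespace Summit.QuantumAdvantage.QuantumAdvantage.Theorems.CertDial
open Finset
open Literature.Computability.QuantumComplexity Literature.Computability.QuantumComplexity.RingHLF
open Summit.QuantumAdvantage.AdviceFreeQNC0
open Literature.Computability.MetaComplexity Literature.Computability.MetaComplexity.Smolensky
open Summit.QuantumAdvantage.QuantumAdvantage.Theorems.RingPeriodFold
  (kvec kernel_pair_of_oddZeros kvec_ne_zero rel_iff_of_kernel_pair)
open Summit.QuantumAdvantage.QuantumAdvantage.Theorems.LightDial (wt lightLosing LightFail mono_singleton_apply)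
open Summit.QuantumAdvantage.QuantumAdvantage.Theorems.ParityDial (PGlobalFail OGlobalFail PLocalFail IsParityLocal par ecntOff ocntOff)
open Summit.QuantumAdvantage.AdviceFreeQNC0.LightConeWindowHard (window)
open Summit.QuantumAdvantage.QuantumAdvantage.Theses.ExactnessDial (NoPerfectTwo3)

variable {n : ℕ}

open Summit.QuantumAdvantage.QuantumAdvantage.Theorems.ParityDial (OffsetCombFail IsOffsetCombLocal)

/-! ## §6 Level 0 is COMPLETE for the special classes: the quantifier swap `∀P ∃x ⟺ ∃x ∀P` for input-wise classes -/

/-- an INPUT-WISE class of strategies: membership is a condition on each answer COLUMN `i ↦ P i x` separately (the condition may depend on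
the input `x`; e.g. «parity-local of radius r», «offset-comb-local of radius r», «window rule with arbitrary input-global advice»). -/
def InputWise (C : (Fin n → Bool) → (Fin n → ZMod 3) → Prop) (P : Fin n → CubeFn (ZMod 3) n) : Prop := ∀ x, C x (fun i => P i x)

/-- the answer bits of a column. -/
def colAns (c : Fin n → ZMod 3) : Fin n → Bool := fun i => decide (c i = 1)

/-- the answer of a strategy at `x` is the answer of its column at `x`. -/
theorem ans_eq_colAns (P : Fin n → CubeFn (ZMod 3) n) (x : Fin n → Bool) : ans P x = colAns (fun i => P i x) := rfl

/-- ★ THEOREM C (QUANTIFIER SWAP — level-0 certificates are COMPLETE for input-wise classes): if every column condition is satisfiable, then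
«every strategy of the class loses on some input of `𝒳`» iff «ONE input of `𝒳` defeats every strategy of the class» (indeed every admissible column).
No finiteness, no degree: pure choice — the class does not couple different inputs. -/
theorem inputWise_fails_iff_universal (C : (Fin n → Bool) → (Fin n → ZMod 3) → Prop) (hC : ∀ x, ∃ c, C x c) (𝒳 : Set (Fin n → Bool)) :
    (∀ P, InputWise C P → ∃ x ∈ 𝒳, ¬ Rel x (ans P x)) ↔ ∃ x ∈ 𝒳, ∀ c, C x c → ¬ Rel x (colAns c) := by
  constructor
  · intro h
    by_contra hne
    push Not at hne
    -- every input of `𝒳` has a winning admissible column: assemble them into one strategy of the class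
    choose c₀ hc₀ using hC
    have hsel : ∀ x, ∃ c, C x c ∧ (x ∈ 𝒳 → Rel x (colAns c)) := fun x => by
      by_cases hx : x ∈ 𝒳
      · obtain ⟨c, hc, hR⟩ := hne x hx; exact ⟨c, hc, fun _ => hR⟩
      · exact ⟨c₀ x, hc₀ x, fun h' => (hx h').elim⟩
    choose c hc hwin using hsel
    obtain ⟨x, hx, hR⟩ := h (fun i x => c x i) (fun x => hc x)
    exact hR (by rw [ans_eq_colAns]; exact hwin x hx)
  · rintro ⟨x, hx, hall⟩ P hP
    exact ⟨x, hx, by rw [ans_eq_colAns]; exact hall _ (hP x)⟩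

/-- the column condition of the even special class. -/
def ParCol (r : ℕ) (x : Fin n → Bool) (c : Fin n → ZMod 3) : Prop :=
  ∀ i j : Fin n, par i = par j → window r x i = window r x j → (c i = 1 ↔ c j = 1)

/-- the column condition of the odd special class. -/
def CombCol (r : ℕ) (x : Fin n → Bool) (c : Fin n → ZMod 3) : Prop :=
  ∀ i j : Fin n, window r x i = window r x j → ecntOff i x = ecntOff j x → ocntOff i x = ocntOff j x → (c i = 1 ↔ c j = 1)

/-- `IsParityLocal r` IS input-wise (definitionally). -/
theorem isParityLocal_iff_inputWise (r : ℕ) (P : Fin n → CubeFn (ZMod 3) n) : IsParityLocal r P ↔ InputWise (ParCol r) P := Iff.rfl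

/-- `IsOffsetCombLocal r` IS input-wise (definitionally). -/
theorem isOffsetCombLocal_iff_inputWise (r : ℕ) (P : Fin n → CubeFn (ZMod 3) n) : IsOffsetCombLocal r P ↔ InputWise (CombCol r) P := Iff.rfl

/-- the zero column is admissible for both. -/
theorem parCol_zero (r : ℕ) (x : Fin n → Bool) : ParCol r x (fun _ => 0) := fun _ _ _ _ => Iff.rfl

/-- the zero column is admissible for both. -/
theorem combCol_zero (r : ℕ) (x : Fin n → Bool) : CombCol r x (fun _ => 0) := fun _ _ _ _ _ => Iff.rfl

/-- ★ even special class: failure on ANY input set is witnessed by ONE universal input of the set. -/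
theorem parityLocal_fails_iff_universal (r : ℕ) (𝒳 : Set (Fin n → Bool)) :
    (∀ P, IsParityLocal r P → ∃ x ∈ 𝒳, ¬ Rel x (ans P x)) ↔ ∃ x ∈ 𝒳, ∀ P, IsParityLocal r P → ¬ Rel x (ans P x) := by
  rw [show (∀ P, IsParityLocal r P → ∃ x ∈ 𝒳, ¬ Rel x (ans P x)) ↔ (∀ P, InputWise (ParCol r) P → ∃ x ∈ 𝒳, ¬ Rel x (ans P x)) from Iff.rfl,
    inputWise_fails_iff_universal (ParCol r) (fun x => ⟨_, parCol_zero r x⟩) 𝒳]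
  constructor
  · rintro ⟨x, hx, h⟩
    exact ⟨x, hx, fun P hP => by rw [ans_eq_colAns]; exact h _ (hP x)⟩
  · rintro ⟨x, hx, h⟩
    refine ⟨x, hx, fun c hc => ?_⟩
    -- extend the column `c` at `x` by zero columns elsewhere: a parity-local strategy
    have hP : IsParityLocal r (fun i y => if y = x then c i else 0) := by
      intro y i j hp hw
      by_cases hy : y = x
      · subst hy; simpa using hc i j hp hw
      · simp [hy]
    have := h _ hP
    rwa [ans_eq_colAns, show (fun i => (fun i y => if y = x then c i else (0 : ZMod 3)) i x) = c from funext fun i => by simp] at this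

/-- ★ odd special class: the same swap. -/
theorem offsetCombLocal_fails_iff_universal (r : ℕ) (𝒳 : Set (Fin n → Bool)) :
    (∀ P, IsOffsetCombLocal r P → ∃ x ∈ 𝒳, ¬ Rel x (ans P x)) ↔ ∃ x ∈ 𝒳, ∀ P, IsOffsetCombLocal r P → ¬ Rel x (ans P x) := by
  rw [show (∀ P, IsOffsetCombLocal r P → ∃ x ∈ 𝒳, ¬ Rel x (ans P x)) ↔ (∀ P, InputWise (CombCol r) P → ∃ x ∈ 𝒳, ¬ Rel x (ans P x))
      from Iff.rfl, inputWise_fails_iff_universal (CombCol r) (fun x => ⟨_, combCol_zero r x⟩) 𝒳]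
  constructor
  · rintro ⟨x, hx, h⟩
    exact ⟨x, hx, fun P hP => by rw [ans_eq_colAns]; exact h _ (hP x)⟩
  · rintro ⟨x, hx, h⟩
    refine ⟨x, hx, fun c hc => ?_⟩
    have hP : IsOffsetCombLocal r (fun i y => if y = x then c i else 0) := by
      intro y i j hw hE hO
      by_cases hy : y = x
      · subst hy; simpa using hc i j hw hE hO
      · simp [hy]
    have := h _ hP
    rwa [ans_eq_colAns, show (fun i => (fun i y => if y = x then c i else (0 : ZMod 3)) i x) = c from funext fun i => by simp] at this

/-- ★ COROLLARY: the even special piece IS «eventually a light universal input exists» — level 0 is not only how g27 proved `PLocalFail`,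
it is the ONLY way it can hold. -/
theorem pLocalFail_iff_universal (r w : ℕ) : PLocalFail r w ↔
    ∃ n₀ : ℕ, ∀ n ≥ n₀, n % 2 = 0 → ∃ x : Fin n → Bool, OddZeros x ∧ LightDial.wt x ≤ w ∧
      ∀ P : Fin n → CubeFn (ZMod 3) n, IsParityLocal r P → ¬ Rel x (ans P x) := by
  unfold PLocalFail
  refine exists_congr fun n₀ => forall_congr' fun n => forall_congr' fun _ => forall_congr' fun _ => ?_
  have h := parityLocal_fails_iff_universal (n := n) r {x | OddZeros x ∧ LightDial.wt x ≤ w}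
  simp only [Set.mem_setOf_eq] at h
  constructor
  · intro H
    obtain ⟨x, ⟨hx, hxw⟩, hall⟩ := h.1 fun P hP => by obtain ⟨x, hx, hxw, hR⟩ := H P hP; exact ⟨x, ⟨hx, hxw⟩, hR⟩
    exact ⟨x, hx, hxw, hall⟩
  · rintro ⟨x, hx, hxw, hall⟩ P hP
    exact ⟨x, hx, hxw, hall P hP⟩

/-- ★ and the odd special piece likewise. -/
theorem offsetCombFail_iff_universal (r w : ℕ) : OffsetCombFail r w ↔
    ∃ n₀ : ℕ, ∀ n ≥ n₀, n % 2 = 1 → ∃ x : Fin n → Bool, OddZeros x ∧ LightDial.wt x ≤ w ∧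
      ∀ P : Fin n → CubeFn (ZMod 3) n, IsOffsetCombLocal r P → ¬ Rel x (ans P x) := by
  unfold OffsetCombFail
  refine exists_congr fun n₀ => forall_congr' fun n => forall_congr' fun _ => forall_congr' fun _ => ?_
  have h := offsetCombLocal_fails_iff_universal (n := n) r {x | OddZeros x ∧ LightDial.wt x ≤ w}
  simp only [Set.mem_setOf_eq] at h
  constructor
  · intro H
    obtain ⟨x, ⟨hx, hxw⟩, hall⟩ := h.1 fun P hP => by obtain ⟨x, hx, hxw, hR⟩ := H P hP; exact ⟨x, ⟨hx, hxw⟩, hR⟩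
    exact ⟨x, hx, hxw, hall⟩
  · rintro ⟨x, hx, hxw, hall⟩ P hP
    exact ⟨x, hx, hxw, hall P hP⟩

/-! ### §6b … and FAILS MAXIMALLY for the generic classes (Corollary B′ in the same language) -/

/-- ★★ THE DICHOTOMY, generic side: for the degree-`≤ D` class (`D ≥ 1`) the swapped statement «a bounded set of light odd-class inputs defeats every
strategy» is FALSE at every large length — for every `M`, eventually no `M` inputs of weight `≤ w` defeat all degree-`≤ D` strategies (indeed one
strategy wins them all).  Together with `parityLocal_fails_iff_universal`: on the special side `∀P ∃x` collapses to `∃x ∀P` (one input), on the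
generic side not even `∃ (M inputs) ∀P` is available, for any fixed `M`. -/
theorem generic_no_bounded_witness (M w : ℕ) {n : ℕ} (hn : 3 ≤ n) (hn' : (M * w + 1) * (2 * M + 1) ≤ n) {D : ℕ} (hD : 1 ≤ D)
    (𝒳 : Finset (Fin n → Bool)) (hM : 𝒳.card ≤ M) (hX : ∀ x ∈ 𝒳, OddZeros x ∧ LightDial.wt x ≤ w) :
    ¬ ∀ P : Fin n → CubeFn (ZMod 3) n, (∀ i, P i ∈ lowDeg (ZMod 3) n D) → ∃ x ∈ 𝒳, ¬ Rel x (ans P x) := by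
  intro h
  obtain ⟨P, hP, hwin⟩ := no_bounded_universal_family M w hn hn' hD 𝒳 hM hX
  obtain ⟨x, hx, hR⟩ := h P hP
  exact hR (hwin x hx)

end Summit.QuantumAdvantage.QuantumAdvantage.Theorems.CertDial
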